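import Summits.QuantumFields.YangMills.Theorems.FluctuationComparisonRegPrIntLS2BetaLiftLadderCombRow
import Summits.QuantumFields.YangMills.Theorems.FluctuationComparisonRegPrIntLS2BetaWeightedTwoProfileTowerSum
import HarnessLib

/-!
# S2β · THE SUP CHAIN, (LIFT-LAD′) — THE FACE ROW, ONE `Params`: THE LIFT ROW AT AN ARBITRARY BOND OF THE RAW DESCENDED PAIR WITH ITS DISCREPANCY SOURCE `ε := R⁻¹·η`
# (`‖log η_raw⁽ʲ⁾(b)‖ ≤ (11∕10)·L⁻¹·(max coarse relative log on the hat feeders of b) + ‖log ε(b)‖` at EVERY bond `b` — no comb hypothesis, no (T4); truncated Pi-sup edition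
# with Young's `κ`-split: the architect's MAX-form `A = (1+κ)·(11∕10)²∕L²` plus the c₃ summand `(1+κ⁻¹)·s²`)

Cell `ym3-torus` (YM ladder rung R3 = continuum `SU(2)` Yang–Mills on the three-torus at fixed lattice data — a RUNG: NOT d = 4, NOT infinite volume,
NOT a mass gap, NOT Clay).  Width seat «width 20» `ym3-torus-px20` (gen 24), FREE px helper on crux `stmt-QuantumFields-20520`
(`…Theses.UnitScaleTilt.FluctuationComparisonRegPrIntL`), LINE g18-1 S2β, the (ST) sup chain: (ST′) ⟸ {(TOP-LAD′), COMB-ROW′, NC-ROW′, (SCT′₁₂₃)} (px10 g25 ✓p831454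
`…S2BetaSupTowerOfLiftLadderNestedSplit` over px17 g22 ✓p830137; COMB-ROW′ = px12 g26 ✓p831211 `…S2BetaLiftLadderCombRow` ∕ ✓p831621 `…Tower`).  THIS FILE is the FACE ROW's
main part as ruled by the architect (px17 g22 19:24:49Z, on px20 g24's 19:24:04Z design note): «the face bond's main part is the LIFT `R(b₀(c)) = expPoint(L⁻¹·logVec η̄(c))`
(off-centre faces: partition-of-unity weights, same `L⁻¹`), so the face row contracts like the comb row, one level up; RULING (ii): INTO `A`, IN MAX FORM,
`A := (1+κ)·max(c_lift², c_face²)∕L²`, `κ := 1∕5`; RULING (i): `c₃(t+1) := (1+κ⁻¹)·Σ_B max_{face-crossing ℓ′ ∈ READ′_{t+1}(B)} |log ε(ℓ′)|²`, `ε := R⁻¹η`; ASSEMBLER px20».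
It is the exact companion of px12 g26's FILE A: there, on a TREE-COMB bond, (T4) makes the stage chord EQUAL to the relative lift chord (✓`stageChord_treeComb_eq_liftChord`);
here, at an ARBITRARY bond (face-crossing ones included), the stage chord `η` is the relative lift chord `R` times the DISCREPANCY `ε := R⁻¹·η`, and the triangle
inequality for the arc (✓`…S2BetaArcBondSplit.norm_logVec_su2Quat_mul_le`) replaces the identity — so `c_face = c_lift = 11∕10` (the hat lift is defined on every fine bond
and px12's ✓`norm_logVec_lift_rel_le_of_arc` ∕ ✓`arc_lift_le` apply verbatim), and the face source is the arc of `ε` (the relative (0.4) correction factor at the central bond,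
px17 ✓p831296 §5 ∕ ✓p831574; the deviation across the face off-centre, px5 Q11; the `eta_factorisation` pen of px12∕px5 bridges to px21 §102.9's `Ad_{δ_U⁻¹}(R)·ε`).
`--kind proof --supports stmt-QuantumFields-20520 --as helper`, count-neutral, DEFINITION-FREE (0 `def`, 0 `instance`, 0 `notation`, 0 `sorry`, default heartbeats);
generic `P : Params`, levels `j` (fine) ∕ `j+1` (coarse), standing range `j + 1 ≤ m + K`; the `AxStage` clause texts (`hwt`, `hlift`, (T3)×4, the bottom relation `hU₀`)
BYTE-IDENTICAL to ✓p831211 §2 (so the tower edition docks into px10 g25's max-form twin of FILE 3″ beside ✓p831621 `combRow'`).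

WHAT IS PROVED (sorry-free).
* §1 ★`norm_logVec_liftChord_le_sharp` — for two coarse fields with arcs `≤ σ` (`σ² ≤ 3∕4`) and relative logs `≤ m` on the hat feeders of ANY fine bond `b`, their hat lifts
  satisfy `‖logVec (su2Quat (V b·(V′ b)⁻¹))‖ ≤ (1 + (2L⁻¹σ)²∕3)·(1 + σ²∕3)·L⁻¹·m` (adapted from ✓`…LiftLadderCombRow.norm_logVec_rawChord_treeComb_le_sharp`, comb hypotheses
  dropped); ★`norm_logVec_liftChord_le_eleven_tenths` — `σ ≤ 1∕4`, `2 ≤ L` ⟹ `≤ (11∕10)·L⁻¹·m`.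
* §2 `norm_logVec_le_add_disc` (`‖log S‖ ≤ a + ‖log (R⁻¹S)‖` if `‖log R‖ ≤ a`); ★★★`norm_logVec_rawChord_le_lift_add_disc` — THE LIFT ROW AT AN ARBITRARY BOND OF THE RAW
  DESCENDED PAIR `(M^jU, M^jU₀)`: `‖logVec (su2Quat (M^jU b·(M^jU₀ b)⁻¹))‖ ≤ (11∕10)·L⁻¹·m + ‖logVec (su2Quat (R_b⁻¹·η_b))‖`, `R_b := lift_j U′_{j+1} b·(lift_j U₁′_{j+1} b)⁻¹`,
  `η_b := U′_j b·(U₁′_j b)⁻¹` (stage chords, `U′_i = g_i • M^iU`, `U₁′_i = g₀_i • M^iU₁`), from (T3)×4 + the bottom relation + arcs `≤ σ ≤ 1∕4` of the two coarse stage fields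
  and raw coarse relative logs `≤ m` on the hat feeders of `b` — NO comb hypothesis, NO (T4).
* §3 ★★`pi_norm_trunc_le_of_row_add` ∕ ★`sq_pi_norm_trunc_le_of_row_add` — the truncated Pi-sup row with an additive source and Young's `κ`-split
  (`‖𝟙_{pS}·f‖² ≤ (1+κ)·c²·‖𝟙_{pT}·f′‖² + (1+κ⁻¹)·s²`, ✓p829914 `sq_le_of_le_mul_add`), companions of ✓p831211 §3.
* §4 ★★★`sq_pi_norm_trunc_le_of_lift_add_disc` — FACE-ROW′ IN ONE `Params`: for ANY bond predicates `pS` (fine) ∕ `pT` (coarse) with the hat feeders of `pS`-bonds inside `pT`,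
  arcs of the two coarse stage fields `≤ σ ≤ 1∕4` on `pT`, `2 ≤ L`, and the discrepancy arcs `≤ s` on `pS`:
  `‖𝟙_{pS}·logVec η_raw⁽ʲ⁾‖² ≤ (1+κ)·((11∕10)·L⁻¹)²·‖𝟙_{pT}·logVec η_raw⁽ʲ⁺¹⁾‖² + (1+κ⁻¹)·s²` for every `κ > 0` (with `pS ⊆` tree-comb bonds and `s = 0`: ✓p831621 §1 up to `1+κ`).
* §5 `disc_eq_one_of_treeComb` (on a tree-comb bond `ε = 1`, by (T4)×2 via ✓`stageChord_treeComb_eq_liftChord`; any `GaugeGroup`); ★★★`sq_pi_norm_trunc_le_of_lift_add_disc_offComb` —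
  the A-ROW for `pS ⊆` tree-comb ∪ face-crossing bonds (FILE 3⁗'s `¬NCI`, px10 g25 ∕ px17 g22 19:33Z): §4 with (T4)×2 added and the discrepancy letter asked ONLY on the
  non-tree-comb `pS`-bonds (= the face-crossing ones for `pS := READ′ ∧ ¬NCI`).

INHABITATION (★★OWNER RULING №100): LAW-FREE — group algebra, the hat lift's log-linearity, Pi-sup bookkeeping; no fibre law, no score, no integrability.  The face SOURCE letter
`hdisc` (arc of `ε` on `pS`) is the one hypothesis a discharger owes: (O3) at the central bond + Q11 ladders off-centre (px17 ∕ px5 ∕ px12 pens by name).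

HONEST SCOPE.  Compositions of landed letters by name; nothing of Bałaban's renormalisation-group analysis is asserted or proved ([Balaban1985RegularSpaces] (1.19) p.79,
(1.29) p.81; [Balaban1985Averaging] (8), (11) p.19, Prop. 4 (128)–(135) pp.37–38 — the printed one-level gauge and sup recursion this row transcribes); the arc profile `σ`,
the discrepancy letter, (TOP-LAD′), COMB-ROW′, NC-ROW′, (SCT′₁₂₃), (ST″)∕(ST′)∕(ST), LOC″∕LOC, AVG₂♭-ax_q are HYPOTHESES of the lane; GAP♯∘ (`stub_uniformFibreGapOrbit`, registry
3732b7df UNTOUCHED), the five registered stubs (0∕5), S2β, 20520, 19936, 19200, `YM3TorusSU2` are NOT proved; no registered stub is closed; rung R3 — NOT d = 4, NOT infinite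
volume, NOT a mass gap, NOT Clay; the Yang–Mills mass gap is NOT proved.
-/

set_option autoImplicit false

namespace Summit.QuantumFields.YangMills.Theorems.FluctuationComparisonRegPrIntLS2BetaLiftLadderFaceRow

open Finset
open scoped Real
open Literature.MathematicalPhysics.QuantumLattice (su2Quat)
open Literature.MathematicalPhysics.QuantumFieldTheory.Balaban1983to89
open T4Continuum
open B10Eq27TorusAxialLog (rel axialT)
open T4CubeChartGnomonic (SU2)
open T4HaarSU2ExpChart (expPoint)
open T4ExpWindowSmallField (logVec)
open Summit.QuantumFields.YangMills.Theorems.FluctuationComparisonRegPrIntLS2BetaLiftLadderCombRow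
  (norm_logVec_rawChord_eq_stageChord norm_logVec_mul_inv_le_add)
open Summit.QuantumFields.YangMills.Theorems.FluctuationComparisonRegPrIntLS2BetaWhitneyHatLiftRelativeSup (norm_logVec_lift_rel_le_of_arc)
open Summit.QuantumFields.YangMills.Theorems.FluctuationComparisonRegPrIntLS2BetaWhitneyHatLift (arc_lift_le)
open Summit.QuantumFields.YangMills.Theorems.FluctuationComparisonRegPrIntLS2BetaGeodesicJensenLift (dist1_le_norm_logVec)
open Summit.QuantumFields.YangMills.Theorems.FluctuationComparisonRegPrIntLS2BetaArcBondSplit (norm_logVec_su2Quat_mul_le)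
open Summit.QuantumFields.YangMills.Theorems.FluctuationComparisonRegPrIntLS2BetaWeightedTwoProfileTowerSum (sq_le_of_le_mul_add)

variable {P : Params}

/-! ## §1 The relative lift chord at ANY fine bond: `≤ c_lift·L⁻¹ ×` the largest coarse relative log on its hat feeders -/

section LiftChord

variable {j : ℕ}

/-- ★ **THE RELATIVE LIFT CHORD AT AN ARBITRARY FINE BOND — SHARP CONSTANT.**  For two coarse fields `X, X′` with arcs `≤ σ` (`σ² ≤ 3∕4`) on the hat feeders of the fine bond `b`
and relative logs `≤ m` there, their hat lifts `V, V′` satisfy `‖logVec (su2Quat (V b·(V′ b)⁻¹))‖ ≤ (1 + (2L⁻¹σ)²∕3)·(1 + σ²∕3)·L⁻¹·m` — no comb hypothesis on `b`: the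
hat lift is defined on every fine bond (face-crossing ones included), and the a priori fine relative arc `≤ 2·L⁻¹·σ` (✓`arc_lift_le` ×2) feeds ✓`norm_logVec_lift_rel_le_of_arc`
exactly as in ✓`…LiftLadderCombRow.norm_logVec_rawChord_treeComb_le_sharp` (adapted from it). [cite: Balaban1985RegularSpaces, (1.29) p.81; Balaban1985Averaging, Prop. 4 (128)-(135) p.37-38] -/
theorem norm_logVec_liftChord_le_sharp (hj : j + 1 ≤ P.m + P.K) (w : PBond P j → PBond P (j + 1) → ℝ)
    (hw : ∀ b e, w b e = if e.dir = b.dir ∧ (b.src b.dir - emb e.src b.dir).val < P.L then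
      ∏ ν ∈ Finset.univ.erase b.dir, max 0 (1 - ((rel (emb e.src) b.src ν).natAbs : ℝ) / P.L) else 0)
    (X X' : GaugeField P (j + 1) SU2) (V V' : GaugeField P j SU2)
    (hV : ∀ b, V b = expPoint (∑ e, w b e • ((P.L : ℝ)⁻¹ • logVec (su2Quat (X e)))))
    (hV' : ∀ b, V' b = expPoint (∑ e, w b e • ((P.L : ℝ)⁻¹ • logVec (su2Quat (X' e)))))
    (b : PBond P j) {σ m : ℝ}
    (hσ : ∀ e, w b e ≠ 0 → ‖logVec (su2Quat (X e))‖ ≤ σ) (hσ' : ∀ e, w b e ≠ 0 → ‖logVec (su2Quat (X' e))‖ ≤ σ) (hσ34 : σ ^ 2 ≤ 3 / 4)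
    (hm : ∀ e, w b e ≠ 0 → ‖logVec (su2Quat (X e * (X' e)⁻¹))‖ ≤ m) :
    ‖logVec (su2Quat (V b * (V' b)⁻¹))‖ ≤ (1 + (2 * ((P.L : ℝ)⁻¹ * σ)) ^ 2 / 3) * ((1 + σ ^ 2 / 3) * ((P.L : ℝ)⁻¹ * m)) := by
  have hσ3 : σ ^ 2 ≤ 3 := hσ34.trans (by norm_num)
  have hmd : ∀ e, w b e ≠ 0 → dist1 (X e * (X' e)⁻¹) ≤ m := fun e he => (dist1_le_norm_logVec _).trans (hm e he)
  have h1 := arc_lift_le hj w hw X V hV b hσ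
  have h2 := arc_lift_le hj w hw X' V' hV' b hσ'
  have hfine : ‖logVec (su2Quat (V b * (V' b)⁻¹))‖ ≤ 2 * ((P.L : ℝ)⁻¹ * σ) := by
    have h := norm_logVec_mul_inv_le_add (V b) (V' b)
    linarith
  have hL0 : 0 ≤ (P.L : ℝ)⁻¹ := inv_nonneg.mpr (Nat.cast_nonneg _)
  have hL1 : (P.L : ℝ)⁻¹ ≤ 1 := by
    have hL : (1 : ℝ) ≤ (P.L : ℝ) := by exact_mod_cast P.hL.2.le
    exact inv_le_one_of_one_le₀ hL
  have hfine3 : (2 * ((P.L : ℝ)⁻¹ * σ)) ^ 2 ≤ 3 := by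
    have h1 : ((P.L : ℝ)⁻¹) ^ 2 ≤ 1 := by nlinarith
    have h2 : ((P.L : ℝ)⁻¹ * σ) ^ 2 ≤ σ ^ 2 := by
      rw [mul_pow]; exact mul_le_of_le_one_left (sq_nonneg σ) h1
    nlinarith
  exact norm_logVec_lift_rel_le_of_arc hj w hw X X' V V' hV hV' b hσ hσ' hσ3 hmd hfine hfine3

/-- ★ **THE NUMERIC EDITION**: `σ ≤ 1∕4`, `2 ≤ L` ⟹ `‖logVec (su2Quat (V b·(V′ b)⁻¹))‖ ≤ (11∕10)·L⁻¹·m` at EVERY fine bond `b` (the same `c_lift ≤ 11∕10` as the comb row, so the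
face bonds' main part enters the lift recursion with `A = (1+κ)·(11∕10)²∕L²` in the architect's MAX form, px17 g22 19:24:49Z ruling (ii)).
[cite: Balaban1985RegularSpaces, (1.29) p.81; Balaban1985Averaging, Prop. 4 (128)-(135) p.37-38] -/
theorem norm_logVec_liftChord_le_eleven_tenths (hj : j + 1 ≤ P.m + P.K) (w : PBond P j → PBond P (j + 1) → ℝ)
    (hw : ∀ b e, w b e = if e.dir = b.dir ∧ (b.src b.dir - emb e.src b.dir).val < P.L then
      ∏ ν ∈ Finset.univ.erase b.dir, max 0 (1 - ((rel (emb e.src) b.src ν).natAbs : ℝ) / P.L) else 0)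
    (X X' : GaugeField P (j + 1) SU2) (V V' : GaugeField P j SU2)
    (hV : ∀ b, V b = expPoint (∑ e, w b e • ((P.L : ℝ)⁻¹ • logVec (su2Quat (X e)))))
    (hV' : ∀ b, V' b = expPoint (∑ e, w b e • ((P.L : ℝ)⁻¹ • logVec (su2Quat (X' e)))))
    (b : PBond P j) {σ m : ℝ} (hL2 : 2 ≤ P.L) (hσ4 : σ ≤ 1 / 4)
    (hσ : ∀ e, w b e ≠ 0 → ‖logVec (su2Quat (X e))‖ ≤ σ) (hσ' : ∀ e, w b e ≠ 0 → ‖logVec (su2Quat (X' e))‖ ≤ σ)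
    (hm : ∀ e, w b e ≠ 0 → ‖logVec (su2Quat (X e * (X' e)⁻¹))‖ ≤ m) :
    ‖logVec (su2Quat (V b * (V' b)⁻¹))‖ ≤ 11 / 10 * ((P.L : ℝ)⁻¹ * m) := by
  have hL0 : 0 ≤ (P.L : ℝ)⁻¹ := inv_nonneg.mpr (Nat.cast_nonneg _)
  have hLhalf : (P.L : ℝ)⁻¹ ≤ 1 / 2 := by
    have h2 : (2 : ℝ) ≤ (P.L : ℝ) := by exact_mod_cast hL2
    rw [inv_le_comm₀ (by linarith) (by norm_num)]
    linarith
  -- route through `σ₊ := max σ 0`, `m₊ := max m 0` (as in ✓`…LiftLadderCombRow.norm_logVec_rawChord_treeComb_le_eleven_tenths`)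
  have hσp : ∀ e, w b e ≠ 0 → ‖logVec (su2Quat (X e))‖ ≤ max σ 0 := fun e he => (hσ e he).trans (le_max_left _ _)
  have hσp' : ∀ e, w b e ≠ 0 → ‖logVec (su2Quat (X' e))‖ ≤ max σ 0 := fun e he => (hσ' e he).trans (le_max_left _ _)
  have hmp : ∀ e, w b e ≠ 0 → ‖logVec (su2Quat (X e * (X' e)⁻¹))‖ ≤ max m 0 := fun e he => (hm e he).trans (le_max_left _ _)
  have hs0 : 0 ≤ max σ 0 := le_max_right _ _
  have hs4 : max σ 0 ≤ 1 / 4 := max_le hσ4 (by norm_num)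
  have hs34 : (max σ 0) ^ 2 ≤ 3 / 4 := by nlinarith
  have h := norm_logVec_liftChord_le_sharp hj w hw X X' V V' hV hV' b hσp hσp' hs34 hmp
  have hc1 : (2 * ((P.L : ℝ)⁻¹ * max σ 0)) ^ 2 / 3 ≤ 1 / 48 := by
    have h1 : 2 * ((P.L : ℝ)⁻¹ * max σ 0) ≤ 1 / 4 := by nlinarith
    have h2 : 0 ≤ 2 * ((P.L : ℝ)⁻¹ * max σ 0) := by positivity
    nlinarith
  have hc2 : (max σ 0) ^ 2 / 3 ≤ 1 / 48 := by nlinarith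
  have hc : (1 + (2 * ((P.L : ℝ)⁻¹ * max σ 0)) ^ 2 / 3) * (1 + (max σ 0) ^ 2 / 3) ≤ 11 / 10 := by nlinarith
  by_cases hm0' : 0 ≤ m
  · have hmm : max m 0 = m := max_eq_left hm0'
    rw [hmm] at h
    calc ‖logVec (su2Quat (V b * (V' b)⁻¹))‖
        ≤ (1 + (2 * ((P.L : ℝ)⁻¹ * max σ 0)) ^ 2 / 3) * ((1 + (max σ 0) ^ 2 / 3) * ((P.L : ℝ)⁻¹ * m)) := h
      _ = ((1 + (2 * ((P.L : ℝ)⁻¹ * max σ 0)) ^ 2 / 3) * (1 + (max σ 0) ^ 2 / 3)) * ((P.L : ℝ)⁻¹ * m) := by ring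
      _ ≤ 11 / 10 * ((P.L : ℝ)⁻¹ * m) := mul_le_mul_of_nonneg_right hc (mul_nonneg hL0 hm0')
  · -- a negative `m` is impossible: the hat support of a fine bond is never empty (✓`sum_hatW_eq_one`)
    exfalso
    have hzero : ∀ e, w b e = 0 := fun e => by
      by_contra he
      exact hm0' ((norm_nonneg _).trans (hm e he))
    have h1 := FluctuationComparisonRegPrIntLS2BetaWhitneyHatWeights.sum_hatW_eq_one hj w hw b
    rw [Finset.sum_eq_zero (fun e _ => hzero e)] at h1
    exact zero_ne_one h1

end LiftChord

/-! ## §2 The raw relative chord at ANY bond: the lift chord times the DISCREPANCY `ε := R⁻¹·η` — `‖log η‖ ≤ (11∕10)·L⁻¹·m + ‖log ε‖` -/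

section RawChord

/-- `‖log S‖ ≤ a + ‖log (R⁻¹·S)‖` as soon as `‖log R‖ ≤ a` (`S = R·(R⁻¹S)` and the triangle inequality for the arc, ✓`norm_logVec_su2Quat_mul_le`). [folklore] -/
theorem norm_logVec_le_add_disc (S R : SU2) {a : ℝ} (hR : ‖logVec (su2Quat R)‖ ≤ a) :
    ‖logVec (su2Quat S)‖ ≤ a + ‖logVec (su2Quat (R⁻¹ * S))‖ := by
  have h := norm_logVec_su2Quat_mul_le R (R⁻¹ * S)
  rw [mul_inv_cancel_left] at h
  linarith

/-- ★★★ **(LIFT-LAD′), THE LIFT ROW AT AN ARBITRARY BOND OF THE RAW DESCENDED PAIR, WITH ITS DISCREPANCY SOURCE.**  One `Params`, levels `j` (fine) ∕ `j+1` (coarse); the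
`AxStage` witness data `(wt, lift, g, g₀, U₁)` with the hat-weight ∕ hat-lift formulas at level `j`, (T3) for both towers at levels `j` and `j+1`, the bottom relation
`U₀ = (g_0⁻¹·g₀_0) • U₁` — and NO comb hypothesis on the bond `b` and NO (T4): writing the stage chord `η := U′_j b·(U₁′_j b)⁻¹` as `R·ε` with `R := V b·(V′ b)⁻¹` the relative chord
of the two hat lifts `V := lift_j U′_{j+1}`, `V′ := lift_j U₁′_{j+1}` and **`ε := R⁻¹·η`** (the architect's c₃ currency, px17 g22 19:24:49Z ruling (i)), the triangle inequality for the
arc (✓`norm_logVec_su2Quat_mul_le`) and §1 give `‖logVec (su2Quat (M^jU b·(M^jU₀ b)⁻¹))‖ ≤ (11∕10)·L⁻¹·m + ‖logVec (su2Quat ε)‖` whenever the two coarse STAGE fields have arcs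
`≤ σ ≤ 1∕4` and the RAW coarse relative logs are `≤ m` on the hat feeders of `b` (`2 ≤ L`).  On a tree-comb bond `ε = 1` by (T4) and this is ✓p831211's comb row; on a
FACE-CROSSING bond `ε` is the face source (relative (0.4) correction factor at the central bond, + the deviation across the face off-centre).
[cite: Balaban1985RegularSpaces, (1.19) p.79, (1.29) p.81; Balaban1985Averaging, (8), (11) p.19, Prop. 4 (128)-(135) p.37-38] -/
theorem norm_logVec_rawChord_le_lift_add_disc (av : ∀ i, Averaging P i SU2) {j : ℕ} (hj : j + 1 ≤ P.m + P.K)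
    (wt : (i : ℕ) → PBond P i → PBond P (i + 1) → ℝ) (lift : (i : ℕ) → GaugeField P (i + 1) SU2 → GaugeField P i SU2)
    (g g₀ : (i : ℕ) → Site P i → SU2) (U U₁ U₀ : GaugeField P 0 SU2)
    (hwt : ∀ b e, wt j b e = if e.dir = b.dir ∧ (b.src b.dir - emb e.src b.dir).val < P.L then
      ∏ ν ∈ Finset.univ.erase b.dir, max 0 (1 - ((rel (emb e.src) b.src ν).natAbs : ℝ) / P.L) else 0)
    (hlift : ∀ (X : GaugeField P (j + 1) SU2) (b : PBond P j), lift j X b = expPoint (∑ e, wt j b e • ((P.L : ℝ)⁻¹ • logVec (su2Quat (X e)))))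
    (hT3 : ∀ X : GaugeField P 0 SU2, Averaging.iter av j (GaugeField.gaugeAct (g 0) X) = GaugeField.gaugeAct (g j) (Averaging.iter av j X))
    (hT3s : ∀ X : GaugeField P 0 SU2, Averaging.iter av (j + 1) (GaugeField.gaugeAct (g 0) X) = GaugeField.gaugeAct (g (j + 1)) (Averaging.iter av (j + 1) X))
    (hT3' : ∀ X : GaugeField P 0 SU2, Averaging.iter av j (GaugeField.gaugeAct (g₀ 0) X) = GaugeField.gaugeAct (g₀ j) (Averaging.iter av j X))
    (hT3s' : ∀ X : GaugeField P 0 SU2, Averaging.iter av (j + 1) (GaugeField.gaugeAct (g₀ 0) X) = GaugeField.gaugeAct (g₀ (j + 1)) (Averaging.iter av (j + 1) X))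
    (hU₀ : U₀ = GaugeField.gaugeAct (fun x => (g 0 x)⁻¹ * g₀ 0 x) U₁)
    (b : PBond P j) {σ m : ℝ} (hL2 : 2 ≤ P.L) (hσ4 : σ ≤ 1 / 4)
    (hσ : ∀ e, wt j b e ≠ 0 → ‖logVec (su2Quat (GaugeField.gaugeAct (g (j + 1)) (Averaging.iter av (j + 1) U) e))‖ ≤ σ)
    (hσ' : ∀ e, wt j b e ≠ 0 → ‖logVec (su2Quat (GaugeField.gaugeAct (g₀ (j + 1)) (Averaging.iter av (j + 1) U₁) e))‖ ≤ σ)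
    (hm : ∀ e, wt j b e ≠ 0 → ‖logVec (su2Quat (Averaging.iter av (j + 1) U e * (Averaging.iter av (j + 1) U₀ e)⁻¹))‖ ≤ m) :
    ‖logVec (su2Quat (Averaging.iter av j U b * (Averaging.iter av j U₀ b)⁻¹))‖ ≤ 11 / 10 * ((P.L : ℝ)⁻¹ * m) +
      ‖logVec (su2Quat ((lift j (GaugeField.gaugeAct (g (j + 1)) (Averaging.iter av (j + 1) U)) b *
          (lift j (GaugeField.gaugeAct (g₀ (j + 1)) (Averaging.iter av (j + 1) U₁)) b)⁻¹)⁻¹ *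
        (GaugeField.gaugeAct (g j) (Averaging.iter av j U) b * (GaugeField.gaugeAct (g₀ j) (Averaging.iter av j U₁) b)⁻¹)))‖ := by
  rw [norm_logVec_rawChord_eq_stageChord av g g₀ U U₁ U₀ hT3 hT3' hU₀ b]
  refine norm_logVec_le_add_disc _ _ ?_
  have hms : ∀ e, wt j b e ≠ 0 → ‖logVec (su2Quat (GaugeField.gaugeAct (g (j + 1)) (Averaging.iter av (j + 1) U) e *
      (GaugeField.gaugeAct (g₀ (j + 1)) (Averaging.iter av (j + 1) U₁) e)⁻¹))‖ ≤ m := fun e he => by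
    rw [← norm_logVec_rawChord_eq_stageChord av g g₀ U U₁ U₀ hT3s hT3s' hU₀ e]
    exact hm e he
  exact norm_logVec_liftChord_le_eleven_tenths hj (wt j) hwt
    (GaugeField.gaugeAct (g (j + 1)) (Averaging.iter av (j + 1) U)) (GaugeField.gaugeAct (g₀ (j + 1)) (Averaging.iter av (j + 1) U₁))
    (lift j (GaugeField.gaugeAct (g (j + 1)) (Averaging.iter av (j + 1) U))) (lift j (GaugeField.gaugeAct (g₀ (j + 1)) (Averaging.iter av (j + 1) U₁)))
    (fun b' => hlift _ b') (fun b' => hlift _ b') b hL2 hσ4 hσ hσ' hms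

end RawChord

/-! ## §3 The truncated Pi-sup forms with an additive source, and Young's `κ`-split -/

section PiSup

variable {α β E : Type*} [Fintype α] [Fintype β] [NormedAddCommGroup E]

/-- ★★ **ROW OF THE TRUNCATED SUP NORMS WITH A SOURCE**: if every `pS`-bond `b` obeys `‖f b‖ ≤ c·m + src b` whenever `‖f′ e‖ ≤ m` on its feeders, all feeders of `pS`-bonds
satisfy `pT`, and `src ≤ s` on `pS` (`0 ≤ c`, `0 ≤ s`), then `‖𝟙_{pS}·f‖_∞ ≤ c·‖𝟙_{pT}·f′‖_∞ + s`. [folklore] -/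
theorem pi_norm_trunc_le_of_row_add (pS : α → Prop) [DecidablePred pS] (pT : β → Prop) [DecidablePred pT] (feeds : α → β → Prop)
    (f : α → E) (f' : β → E) {c : ℝ} (hc : 0 ≤ c) (src : α → ℝ) {s : ℝ} (hs0 : 0 ≤ s) (hsrc : ∀ b, pS b → src b ≤ s)
    (hrow : ∀ b, pS b → ∀ m : ℝ, (∀ e, feeds b e → ‖f' e‖ ≤ m) → ‖f b‖ ≤ c * m + src b)
    (hfeed : ∀ b, pS b → ∀ e, feeds b e → pT e) :
    ‖(fun b => if pS b then f b else 0)‖ ≤ c * ‖(fun e => if pT e then f' e else 0)‖ + s := by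
  refine (pi_norm_le_iff_of_nonneg (add_nonneg (mul_nonneg hc (norm_nonneg _)) hs0)).2 fun b => ?_
  by_cases hb : pS b
  · rw [if_pos hb]
    refine (hrow b hb _ fun e he => ?_).trans (add_le_add le_rfl (hsrc b hb))
    have h1 : ‖(fun e => if pT e then f' e else 0) e‖ ≤ ‖(fun e => if pT e then f' e else 0)‖ :=
      norm_le_pi_norm (fun e => if pT e then f' e else 0) e
    simpa only [if_pos (hfeed b hb e he)] using h1
  · rw [if_neg hb, norm_zero]
    exact add_nonneg (mul_nonneg hc (norm_nonneg _)) hs0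

/-- ★ **THE SQUARED ROW WITH YOUNG's `κ`-SPLIT**: under the same hypotheses, for every `κ > 0`,
`‖𝟙_{pS}·f‖² ≤ (1+κ)·c²·‖𝟙_{pT}·f′‖² + (1+κ⁻¹)·s²` (✓`sq_le_of_le_mul_add`). [folklore] -/
theorem sq_pi_norm_trunc_le_of_row_add (pS : α → Prop) [DecidablePred pS] (pT : β → Prop) [DecidablePred pT] (feeds : α → β → Prop)
    (f : α → E) (f' : β → E) {c : ℝ} (hc : 0 ≤ c) (src : α → ℝ) {s : ℝ} (hs0 : 0 ≤ s) (hsrc : ∀ b, pS b → src b ≤ s)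
    (hrow : ∀ b, pS b → ∀ m : ℝ, (∀ e, feeds b e → ‖f' e‖ ≤ m) → ‖f b‖ ≤ c * m + src b)
    (hfeed : ∀ b, pS b → ∀ e, feeds b e → pT e) {κ : ℝ} (hκ : 0 < κ) :
    ‖(fun b => if pS b then f b else 0)‖ ^ 2 ≤
      (1 + κ) * c ^ 2 * ‖(fun e => if pT e then f' e else 0)‖ ^ 2 + (1 + κ⁻¹) * s ^ 2 :=
  sq_le_of_le_mul_add (norm_nonneg _) hc (norm_nonneg _) hκ
    (pi_norm_trunc_le_of_row_add pS pT feeds f f' hc src hs0 hsrc hrow hfeed)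

end PiSup

/-! ## §4 THE FACE ROW OF THE TRUNCATED SUP NORMS, ONE `Params`: lift part (`A`-term, MAX-form ready) + the discrepancy source `(1+κ⁻¹)·s²` -/

section OneParams

/-- ★★★ **FACE-ROW′ IN ONE `Params`** (levels `j` fine ∕ `j+1` coarse; `AxStage` clause texts as in ✓p831211 §2 — (T4) NOT needed; ANY bond predicates `pS`, `pT`): if the hat
feeders of `pS`-bonds satisfy `pT`, the two level-`(j+1)` stage fields have arcs `≤ σ ≤ 1∕4` on `pT`, `2 ≤ L`, and the DISCREPANCY `ε_b := R_b⁻¹·η_b` (`R_b` the relative lift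
chord, `η_b` the stage chord) has arc `≤ s` on `pS` (the face source letter — the relative (0.4) correction factor ∕ the deviation across the face, supplied by (O3)∕Q11), then for
every `κ > 0`: `‖𝟙_{pS}·logVec η_raw⁽ʲ⁾‖² ≤ (1+κ)·((11∕10)·L⁻¹)²·‖𝟙_{pT}·logVec η_raw⁽ʲ⁺¹⁾‖² + (1+κ⁻¹)·s²` — the architect's MAX-form `A = (1+κ)·(11∕10)²∕L²` (`κ = 1∕5`:
`A·L = 0.484 ≤ ½` at `L = 3`) with the c₃ summand `(1+κ⁻¹)·s²` (px17 g22 19:24:49Z rulings (i)–(ii)).  With `pS ⊆` tree-comb bonds and `s = 0` it is ✓`sq_pi_norm_trunc_le_of_treeComb`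
up to the factor `1+κ`. [cite: Balaban1985RegularSpaces, (1.29) p.81; Balaban1985Averaging, Prop. 4 (128)-(135) p.37-38] -/
theorem sq_pi_norm_trunc_le_of_lift_add_disc (av : ∀ i, Averaging P i SU2) {j : ℕ} (hj : j + 1 ≤ P.m + P.K)
    (wt : (i : ℕ) → PBond P i → PBond P (i + 1) → ℝ) (lift : (i : ℕ) → GaugeField P (i + 1) SU2 → GaugeField P i SU2)
    (g g₀ : (i : ℕ) → Site P i → SU2) (U U₁ U₀ : GaugeField P 0 SU2)
    (hwt : ∀ b e, wt j b e = if e.dir = b.dir ∧ (b.src b.dir - emb e.src b.dir).val < P.L then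
      ∏ ν ∈ Finset.univ.erase b.dir, max 0 (1 - ((rel (emb e.src) b.src ν).natAbs : ℝ) / P.L) else 0)
    (hlift : ∀ (X : GaugeField P (j + 1) SU2) (b : PBond P j), lift j X b = expPoint (∑ e, wt j b e • ((P.L : ℝ)⁻¹ • logVec (su2Quat (X e)))))
    (hT3 : ∀ X : GaugeField P 0 SU2, Averaging.iter av j (GaugeField.gaugeAct (g 0) X) = GaugeField.gaugeAct (g j) (Averaging.iter av j X))
    (hT3s : ∀ X : GaugeField P 0 SU2, Averaging.iter av (j + 1) (GaugeField.gaugeAct (g 0) X) = GaugeField.gaugeAct (g (j + 1)) (Averaging.iter av (j + 1) X))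
    (hT3' : ∀ X : GaugeField P 0 SU2, Averaging.iter av j (GaugeField.gaugeAct (g₀ 0) X) = GaugeField.gaugeAct (g₀ j) (Averaging.iter av j X))
    (hT3s' : ∀ X : GaugeField P 0 SU2, Averaging.iter av (j + 1) (GaugeField.gaugeAct (g₀ 0) X) = GaugeField.gaugeAct (g₀ (j + 1)) (Averaging.iter av (j + 1) X))
    (hU₀ : U₀ = GaugeField.gaugeAct (fun x => (g 0 x)⁻¹ * g₀ 0 x) U₁)
    (hL2 : 2 ≤ P.L) {σ : ℝ} (hσ4 : σ ≤ 1 / 4)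
    (pS : PBond P j → Prop) [DecidablePred pS] (pT : PBond P (j + 1) → Prop) [DecidablePred pT]
    (hnest : ∀ b, pS b → ∀ e, wt j b e ≠ 0 → pT e)
    (hσ : ∀ e, pT e → ‖logVec (su2Quat (GaugeField.gaugeAct (g (j + 1)) (Averaging.iter av (j + 1) U) e))‖ ≤ σ)
    (hσ' : ∀ e, pT e → ‖logVec (su2Quat (GaugeField.gaugeAct (g₀ (j + 1)) (Averaging.iter av (j + 1) U₁) e))‖ ≤ σ)
    {s : ℝ} (hs0 : 0 ≤ s)
    (hdisc : ∀ b, pS b →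
      ‖logVec (su2Quat ((lift j (GaugeField.gaugeAct (g (j + 1)) (Averaging.iter av (j + 1) U)) b *
          (lift j (GaugeField.gaugeAct (g₀ (j + 1)) (Averaging.iter av (j + 1) U₁)) b)⁻¹)⁻¹ *
        (GaugeField.gaugeAct (g j) (Averaging.iter av j U) b * (GaugeField.gaugeAct (g₀ j) (Averaging.iter av j U₁) b)⁻¹)))‖ ≤ s)
    {κ : ℝ} (hκ : 0 < κ) :
    ‖(fun b : PBond P j => if pS b then logVec (su2Quat (Averaging.iter av j U b * (Averaging.iter av j U₀ b)⁻¹)) else 0)‖ ^ 2 ≤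
      (1 + κ) * (11 / 10 * (P.L : ℝ)⁻¹) ^ 2 *
        ‖(fun e : PBond P (j + 1) => if pT e then logVec (su2Quat (Averaging.iter av (j + 1) U e * (Averaging.iter av (j + 1) U₀ e)⁻¹)) else 0)‖ ^ 2 +
      (1 + κ⁻¹) * s ^ 2 := by
  refine sq_pi_norm_trunc_le_of_row_add pS pT (fun b e => wt j b e ≠ 0)
    (fun b => logVec (su2Quat (Averaging.iter av j U b * (Averaging.iter av j U₀ b)⁻¹)))
    (fun e => logVec (su2Quat (Averaging.iter av (j + 1) U e * (Averaging.iter av (j + 1) U₀ e)⁻¹)))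
    (by positivity)
    (fun b => ‖logVec (su2Quat ((lift j (GaugeField.gaugeAct (g (j + 1)) (Averaging.iter av (j + 1) U)) b *
          (lift j (GaugeField.gaugeAct (g₀ (j + 1)) (Averaging.iter av (j + 1) U₁)) b)⁻¹)⁻¹ *
        (GaugeField.gaugeAct (g j) (Averaging.iter av j U) b * (GaugeField.gaugeAct (g₀ j) (Averaging.iter av j U₁) b)⁻¹)))‖)
    hs0 hdisc (fun b hb m hm => ?_) hnest hκ
  have h := norm_logVec_rawChord_le_lift_add_disc av hj wt lift g g₀ U U₁ U₀ hwt hlift hT3 hT3s hT3' hT3s' hU₀ b hL2 hσ4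
    (fun e he => hσ e (hnest b hb e he)) (fun e he => hσ' e (hnest b hb e he)) hm
  calc ‖logVec (su2Quat (Averaging.iter av j U b * (Averaging.iter av j U₀ b)⁻¹))‖
      ≤ 11 / 10 * ((P.L : ℝ)⁻¹ * m) + _ := h
    _ = 11 / 10 * (P.L : ℝ)⁻¹ * m + _ := by ring

end OneParams

/-! ## §5 On tree-comb bonds the discrepancy is `1` ((T4)), so the source is read on the NON-comb part of `pS` only — the A-row `pS := READ′ ∧ ¬NCI` of FILE 3⁗ -/

section OffComb

open Summit.QuantumFields.YangMills.Theorems.FluctuationComparisonRegPrIntLS2BetaTreeCombBondStep (stageChord_treeComb_eq_liftChord)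

/-- **ON A TREE-COMB BOND THE DISCREPANCY IS `1`**: (T4) for both towers identifies the stage chord with the relative lift chord there
(✓`stageChord_treeComb_eq_liftChord`), so `ε = R⁻¹·η = 1`. [cite: Balaban1985RegularSpaces, (1.19) p.79; Balaban1985Averaging, (58) p.27] -/
theorem disc_eq_one_of_treeComb {G : Type*} [GaugeGroup G] (av : ∀ i, Averaging P i G) {j : ℕ} (hj : j + 1 ≤ P.m + P.K)
    (lift : (i : ℕ) → GaugeField P (i + 1) G → GaugeField P i G) (g g₀ : (i : ℕ) → Site P i → G) (U U₁ : GaugeField P 0 G)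
    (hT4 : ∀ x, axialT (GaugeField.gaugeAct (g j) (Averaging.iter av j U)) (emb (blockOf x)) x =
      axialT (lift j (GaugeField.gaugeAct (g (j + 1)) (Averaging.iter av (j + 1) U))) (emb (blockOf x)) x)
    (hT4' : ∀ x, axialT (GaugeField.gaugeAct (g₀ j) (Averaging.iter av j U₁)) (emb (blockOf x)) x =
      axialT (lift j (GaugeField.gaugeAct (g₀ (j + 1)) (Averaging.iter av (j + 1) U₁))) (emb (blockOf x)) x)
    (x : Site P j) (μ : Fin P.d) (hblk : blockOf (x.shift μ) = blockOf x) (hlo : ∀ ν, ν < μ → rel (emb (blockOf x)) x ν = 0) :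
    (lift j (GaugeField.gaugeAct (g (j + 1)) (Averaging.iter av (j + 1) U)) ⟨x, μ⟩ *
        (lift j (GaugeField.gaugeAct (g₀ (j + 1)) (Averaging.iter av (j + 1) U₁)) ⟨x, μ⟩)⁻¹)⁻¹ *
      (GaugeField.gaugeAct (g j) (Averaging.iter av j U) ⟨x, μ⟩ * (GaugeField.gaugeAct (g₀ j) (Averaging.iter av j U₁) ⟨x, μ⟩)⁻¹) = 1 := by
  rw [stageChord_treeComb_eq_liftChord av hj lift g g₀ U U₁ hT4 hT4' x μ hblk hlo, inv_mul_cancel]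

/-- ★★★ **THE A-ROW FOR `pS ⊆` TREE-COMB ∪ FACE-CROSSING BONDS** (FILE 3⁗'s `¬NCI` predicate, px10 g25 ∕ px17 g22 19:33Z): as ✓`sq_pi_norm_trunc_le_of_lift_add_disc`, with
(T4) for both towers added and the discrepancy letter asked ONLY on the `pS`-bonds that are NOT tree-comb (there `ε = 1` by ✓`disc_eq_one_of_treeComb`); for `pS := READ′ ∧ ¬NCI`
these are exactly the face-crossing bonds. [cite: Balaban1985RegularSpaces, (1.19) p.79, (1.29) p.81; Balaban1985Averaging, Prop. 4 (128)-(135) p.37-38] -/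
theorem sq_pi_norm_trunc_le_of_lift_add_disc_offComb (av : ∀ i, Averaging P i SU2) {j : ℕ} (hj : j + 1 ≤ P.m + P.K)
    (wt : (i : ℕ) → PBond P i → PBond P (i + 1) → ℝ) (lift : (i : ℕ) → GaugeField P (i + 1) SU2 → GaugeField P i SU2)
    (g g₀ : (i : ℕ) → Site P i → SU2) (U U₁ U₀ : GaugeField P 0 SU2)
    (hwt : ∀ b e, wt j b e = if e.dir = b.dir ∧ (b.src b.dir - emb e.src b.dir).val < P.L then
      ∏ ν ∈ Finset.univ.erase b.dir, max 0 (1 - ((rel (emb e.src) b.src ν).natAbs : ℝ) / P.L) else 0)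
    (hlift : ∀ (X : GaugeField P (j + 1) SU2) (b : PBond P j), lift j X b = expPoint (∑ e, wt j b e • ((P.L : ℝ)⁻¹ • logVec (su2Quat (X e)))))
    (hT3 : ∀ X : GaugeField P 0 SU2, Averaging.iter av j (GaugeField.gaugeAct (g 0) X) = GaugeField.gaugeAct (g j) (Averaging.iter av j X))
    (hT3s : ∀ X : GaugeField P 0 SU2, Averaging.iter av (j + 1) (GaugeField.gaugeAct (g 0) X) = GaugeField.gaugeAct (g (j + 1)) (Averaging.iter av (j + 1) X))
    (hT3' : ∀ X : GaugeField P 0 SU2, Averaging.iter av j (GaugeField.gaugeAct (g₀ 0) X) = GaugeField.gaugeAct (g₀ j) (Averaging.iter av j X))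
    (hT3s' : ∀ X : GaugeField P 0 SU2, Averaging.iter av (j + 1) (GaugeField.gaugeAct (g₀ 0) X) = GaugeField.gaugeAct (g₀ (j + 1)) (Averaging.iter av (j + 1) X))
    (hU₀ : U₀ = GaugeField.gaugeAct (fun x => (g 0 x)⁻¹ * g₀ 0 x) U₁)
    (hT4 : ∀ x, axialT (GaugeField.gaugeAct (g j) (Averaging.iter av j U)) (emb (blockOf x)) x =
      axialT (lift j (GaugeField.gaugeAct (g (j + 1)) (Averaging.iter av (j + 1) U))) (emb (blockOf x)) x)
    (hT4' : ∀ x, axialT (GaugeField.gaugeAct (g₀ j) (Averaging.iter av j U₁)) (emb (blockOf x)) x =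
      axialT (lift j (GaugeField.gaugeAct (g₀ (j + 1)) (Averaging.iter av (j + 1) U₁))) (emb (blockOf x)) x)
    (hL2 : 2 ≤ P.L) {σ : ℝ} (hσ4 : σ ≤ 1 / 4)
    (pS : PBond P j → Prop) [DecidablePred pS] (pT : PBond P (j + 1) → Prop) [DecidablePred pT]
    (hnest : ∀ b, pS b → ∀ e, wt j b e ≠ 0 → pT e)
    (hσ : ∀ e, pT e → ‖logVec (su2Quat (GaugeField.gaugeAct (g (j + 1)) (Averaging.iter av (j + 1) U) e))‖ ≤ σ)
    (hσ' : ∀ e, pT e → ‖logVec (su2Quat (GaugeField.gaugeAct (g₀ (j + 1)) (Averaging.iter av (j + 1) U₁) e))‖ ≤ σ)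
    {s : ℝ} (hs0 : 0 ≤ s)
    (hdisc : ∀ b, pS b → ¬ (blockOf (b.src.shift b.dir) = blockOf b.src ∧ ∀ ν, ν < b.dir → rel (emb (blockOf b.src)) b.src ν = 0) →
      ‖logVec (su2Quat ((lift j (GaugeField.gaugeAct (g (j + 1)) (Averaging.iter av (j + 1) U)) b *
          (lift j (GaugeField.gaugeAct (g₀ (j + 1)) (Averaging.iter av (j + 1) U₁)) b)⁻¹)⁻¹ *
        (GaugeField.gaugeAct (g j) (Averaging.iter av j U) b * (GaugeField.gaugeAct (g₀ j) (Averaging.iter av j U₁) b)⁻¹)))‖ ≤ s)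
    {κ : ℝ} (hκ : 0 < κ) :
    ‖(fun b : PBond P j => if pS b then logVec (su2Quat (Averaging.iter av j U b * (Averaging.iter av j U₀ b)⁻¹)) else 0)‖ ^ 2 ≤
      (1 + κ) * (11 / 10 * (P.L : ℝ)⁻¹) ^ 2 *
        ‖(fun e : PBond P (j + 1) => if pT e then logVec (su2Quat (Averaging.iter av (j + 1) U e * (Averaging.iter av (j + 1) U₀ e)⁻¹)) else 0)‖ ^ 2 +
      (1 + κ⁻¹) * s ^ 2 := by
  refine sq_pi_norm_trunc_le_of_lift_add_disc av hj wt lift g g₀ U U₁ U₀ hwt hlift hT3 hT3s hT3' hT3s' hU₀ hL2 hσ4 pS pT hnest hσ hσ' hs0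
    (fun b hb => ?_) hκ
  by_cases hcomb : blockOf (b.src.shift b.dir) = blockOf b.src ∧ ∀ ν, ν < b.dir → rel (emb (blockOf b.src)) b.src ν = 0
  · obtain ⟨x, μ⟩ := b
    rw [disc_eq_one_of_treeComb av hj lift g g₀ U U₁ hT4 hT4' x μ hcomb.1 hcomb.2,
      FluctuationComparisonRegPrIntLS2BetaWhitneyHatLift.logVec_su2Quat_one, norm_zero]
    exact hs0
  · exact hdisc b hb hcomb

end OffComb

end Summit.QuantumFields.YangMills.Theorems.FluctuationComparisonRegPrIntLS2BetaLiftLadderFaceRow
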